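import Summits.CriticalPhenomena.PercolationContinuityZ3.Theorems.FK.MagnetizationFieldDerivative
import Literature.Probability.LatticeModels.PositiveFieldUniqueness
import Literature.Probability.LatticeModels.IsingTranslationInvariance
import Literature.Probability.LatticeModels.PlusStateFKG
import Literature.Probability.LatticeModels.MeanFieldBoundGHS
import Summits.CriticalPhenomena.PercolationContinuityZ3.Theorems.FK.LatticeEdgeCounting
import HarnessLib

/-!
# THE FREE-BOUNDARY MAGNETISATION DENSITY OF A BOX CONVERGES TO `m(β,h)`:
# `|Λ_L|⁻¹ Σ_{x∈Λ_L} ⟨σ_x⟩^∅_{Λ_L;β,h} → m(β,h)` for `h > 0` (Friedli–Velenik 2017, §3.7, proof of Thm. 3.43 / Prop. 3.29)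

Claimed R42 (8)(c) in the cell INBOX at 2026-08-28T22:45:16Z by fkp-10a gen 356 (NEW CLAIM #2 of the gen), addressed to coordinator fk-4 gen 283 (seated 21:31Z 2026-08-28 by l.8554; R157 in force); lineage row FO-10a-g356p (self-suggested), package g356-pressure, label PD-B.
Helper file of the `fk-continuity` build cell (bschramm lane; `--supports stmt-CriticalPhenomena-4575`); builds on
p205010 (kernel theorem, internal audit signed; external expert review pending). No definitions, no named facts, no
sorries; standard axioms. UNCONDITIONAL (nearest-neighbour Ising model on `ℤ^d`, `d ≥ 1`).

The `h`-derivative of the finite-volume free pressure `ψ^∅_Λ(β,h) = |Λ|⁻¹ log Z^∅_{Λ;β,h}` is `β` times the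
magnetisation DENSITY `|Λ|⁻¹ Σ_{x∈Λ} ⟨σ_x⟩^∅_{Λ;β,h}` (all sites, boundary ones included). To identify the field
derivative of the infinite-volume pressure one needs its limit along boxes; here, by GKS monotonicity in the volume
and translation covariance, for `β ≥ 0`, `h > 0`:

* `isingCorr_free_box_singleton_le_magnetizationInField` — every term is `≤ ⟨σ_x⟩^∅_{β,h} = ⟨σ_0⟩^∅_{β,h} = m(β,h)`
  (free = plus one-point function at `h > 0`, the tree's `freeCorr_eq_plusCorr_singleton_of_pos_holds`);
* `isingCorr_free_box_zero_le_of_supNorm` — a site `x` at sup-distance `≥ K` from the complement sees at least the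
  centred box `Λ_K`: `⟨σ_0⟩^∅_{Λ_K} ≤ ⟨σ_x⟩^∅_{Λ_L}` (`‖x‖_∞ + K ≤ L`);
* `card_mul_le_sum_isingCorr_free_box_singleton` — hence `|Λ_{L−K}| ⟨σ_0⟩^∅_{Λ_K} ≤ Σ_{x∈Λ_L} ⟨σ_x⟩^∅_{Λ_L}`;
* `|Λ_{L−K}|/|Λ_L| → 1` is the tree's `tendsto_card_box_sub_div_card_box` (`LatticeEdgeCounting`);
* **`tendsto_boxAverage_isingCorr_free_singleton`** — `|Λ_L|⁻¹ Σ_{x∈Λ_L} ⟨σ_x⟩^∅_{Λ_L;β,h} → m(β,h)` (`h > 0`), and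
  `boxAverage_isingCorr_free_singleton_zero_field` — the average is `0` at `h = 0` (spin flip).

## References

* S. Friedli, Y. Velenik, *Statistical Mechanics of Lattice Systems*, CUP (2017), §3.2.3 eq. (3.7), Prop. 3.29 and its
  proof, Exercise 3.12, Exercise 3.16, Thm. 3.25. [FriedliVelenik2017]
* R. S. Ellis, *Entropy, Large Deviations, and Statistical Mechanics*, Springer (1985/2006), Thm. V.4.3, Lemma V.4.5
  («`m(β,h) = lim ⟨Y_0⟩_{Λ,β,h,+}`»). [Ellis2006]
-/

noncomputable section

namespace Summit.CriticalPhenomena.PercolationContinuityZ3.Theorems.FK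

namespace IsingSusceptibility

open MeasureTheory Filter Topology Finset Set
open Literature.Probability.LatticeModels

variable {d : ℕ}

/-! ### Pointwise bounds on `⟨σ_x⟩^∅_{Λ_L;β,h}` -/

/-- **Upper bound**: for `d ≥ 1`, `β ≥ 0`, `h > 0` and `x ∈ Λ_L`, `⟨σ_x⟩^∅_{Λ_L;β,h} ≤ m(β,h)` (GKS monotonicity in the
volume up to the free state, translation invariance of the free state, and free = plus for the one-point function in a
positive field). [cite: FriedliVelenik2017, Exercise 3.12, Exercise 3.16 and Thm. 3.25 (1)] -/
theorem isingCorr_free_box_singleton_le_magnetizationInField (hd : 1 ≤ d) {β h : ℝ} (hβ : 0 ≤ β) (hh : 0 < h) {L : ℕ}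
    {x : Site d} (hx : x ∈ box d L) :
    isingCorr (zdGraph d) (box d L) β h .free {x} ≤ magnetizationInField d β h := by
  have hm : magnetizationInField d β h = plusCorr d β h {0} := by
    simp only [magnetizationInField, plusCorr, spinProduct_singleton]
  calc isingCorr (zdGraph d) (box d L) β h .free {x}
      ≤ freeCorr d β h {x} := isingCorr_free_box_le_freeCorr hβ hh.le (Finset.singleton_subset_iff.2 hx)
    _ = freeCorr d β h {0} := by rw [← map_singleton_zero_shift x, freeCorr_shift d hβ hh.le x {0}]
    _ = magnetizationInField d β h := by rw [freeCorr_eq_plusCorr_singleton_of_pos_holds hd hβ hh, hm]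

/-- **Lower bound by an inner box**: for `β, h ≥ 0` and a site `x` with `‖x‖_∞ + K ≤ L`,
`⟨σ_0⟩^∅_{Λ_K;β,h} ≤ ⟨σ_x⟩^∅_{Λ_L;β,h}` (the translate `x + Λ_K ⊆ Λ_L`, translation covariance
`isingCorr_free_map_shift`, GKS monotonicity `isingCorr_free_le_of_subset`). [cite: FriedliVelenik2017, Exercise 3.12 and Exercise 3.14] -/
theorem isingCorr_free_box_zero_le_of_supNorm {β h : ℝ} (hβ : 0 ≤ β) (hh : 0 ≤ h) {K L : ℕ} {x : Site d}
    (hx : Site.supNorm x + K ≤ L) :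
    isingCorr (zdGraph d) (box d K) β h .free {0} ≤ isingCorr (zdGraph d) (box d L) β h .free {x} := by
  rw [← isingCorr_free_map_shift d x (box d K) β h {0}, map_singleton_zero_shift]
  refine isingCorr_free_le_of_subset (zdGraph d) hβ hh ?_ ?_
  · rw [Finset.singleton_subset_iff, mem_map_shift_iff', sub_self]
    exact zero_mem_box d K
  · exact (map_shift_box_subset K x).trans (box_mono d (by omega))

/-- All terms are nonnegative (GKS I, `h ≥ 0`). [cite: FriedliVelenik2017, Thm. 3.20, eq. (3.21)] -/
theorem isingCorr_free_box_singleton_nonneg {β h : ℝ} (hβ : 0 ≤ β) (hh : 0 ≤ h) {L : ℕ} {x : Site d}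
    (hx : x ∈ box d L) : 0 ≤ isingCorr (zdGraph d) (box d L) β h .free {x} :=
  GKSInequalities.gks_one_holds (zdGraph d) hβ hh (Or.inl rfl) (Finset.singleton_subset_iff.2 hx)

/-- **The inner-box lower bound, summed**: for `β, h ≥ 0` and `K ≤ L`,
`|Λ_{L−K}| · ⟨σ_0⟩^∅_{Λ_K;β,h} ≤ Σ_{x∈Λ_L} ⟨σ_x⟩^∅_{Λ_L;β,h}`. [cite: FriedliVelenik2017, Prop. 3.29 (proof)] -/
theorem card_mul_le_sum_isingCorr_free_box_singleton {β h : ℝ} (hβ : 0 ≤ β) (hh : 0 ≤ h) {K L : ℕ} (hKL : K ≤ L) :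
    (#(box d (L - K)) : ℝ) * isingCorr (zdGraph d) (box d K) β h .free {0} ≤
      ∑ x ∈ box d L, isingCorr (zdGraph d) (box d L) β h .free {x} := by
  calc (#(box d (L - K)) : ℝ) * isingCorr (zdGraph d) (box d K) β h .free {0}
      = ∑ _x ∈ box d (L - K), isingCorr (zdGraph d) (box d K) β h .free {0} := by simp
    _ ≤ ∑ x ∈ box d (L - K), isingCorr (zdGraph d) (box d L) β h .free {x} :=
        Finset.sum_le_sum fun x hx => isingCorr_free_box_zero_le_of_supNorm hβ hh (by
          have := mem_box_iff_supNorm_le.1 hx; omega)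
    _ ≤ ∑ x ∈ box d L, isingCorr (zdGraph d) (box d L) β h .free {x} :=
        Finset.sum_le_sum_of_subset_of_nonneg (box_mono d (Nat.sub_le L K)) fun x hx _ =>
          isingCorr_free_box_singleton_nonneg hβ hh hx

/-! ### The limits of the box averages -/

/-- **THE FREE MAGNETISATION DENSITY OF A BOX CONVERGES TO `m(β,h)`** (Friedli–Velenik 2017, proof of Prop. 3.29 / §3.7:
the per-site magnetisation of the free finite-volume state): for `d ≥ 1`, `β ≥ 0`, `h > 0`,
`|Λ_L|⁻¹ Σ_{x∈Λ_L} ⟨σ_x⟩^∅_{Λ_L;β,h} → m(β,h) = ⟨σ_0⟩⁺_{β,h}` as `L → ∞`.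
[cite: FriedliVelenik2017, Prop. 3.29 (proof) and Thm. 3.25; Ellis2006, Lemma V.4.5] -/
theorem tendsto_boxAverage_isingCorr_free_singleton (hd : 1 ≤ d) {β h : ℝ} (hβ : 0 ≤ β) (hh : 0 < h) :
    Tendsto (fun L : ℕ => (∑ x ∈ box d L, isingCorr (zdGraph d) (box d L) β h .free {x}) / #(box d L)) atTop
      (𝓝 (magnetizationInField d β h)) := by
  have hcard : ∀ L : ℕ, (0 : ℝ) < #(box d L) := fun L => by exact_mod_cast Finset.card_pos.2 (box_nonempty d L)
  -- upper bound: the average is `≤ m`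
  have hup : ∀ L : ℕ, (∑ x ∈ box d L, isingCorr (zdGraph d) (box d L) β h .free {x}) / #(box d L) ≤
      magnetizationInField d β h := fun L => by
    rw [div_le_iff₀ (hcard L)]
    calc ∑ x ∈ box d L, isingCorr (zdGraph d) (box d L) β h .free {x}
        ≤ ∑ _x ∈ box d L, magnetizationInField d β h :=
          Finset.sum_le_sum fun x hx => isingCorr_free_box_singleton_le_magnetizationInField hd hβ hh hx
      _ = magnetizationInField d β h * #(box d L) := by simp [mul_comm]
  -- the inner boxes converge to `m`
  have hK : Tendsto (fun K : ℕ => isingCorr (zdGraph d) (box d K) β h .free {0}) atTop (𝓝 (magnetizationInField d β h)) := by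
    have hm : magnetizationInField d β h = freeCorr d β h {0} := by
      rw [freeCorr_eq_plusCorr_singleton_of_pos_holds hd hβ hh]
      simp only [magnetizationInField, plusCorr, spinProduct_singleton]
    rw [hm]
    exact hasBoxLimit_isingCorr_free_holds hβ hh.le {0}
  refine tendsto_order.2 ⟨fun a ha => ?_, fun a ha => Eventually.of_forall fun L => (hup L).trans_lt ha⟩
  obtain ⟨K, hKa⟩ := ((tendsto_order.1 hK).1 a ha).exists
  have hratio := (Summit.CriticalPhenomena.PercolationContinuityZ3.Theorems.FK.tendsto_card_box_sub_div_card_box (d := d) K).mul_const (isingCorr (zdGraph d) (box d K) β h .free {0})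
  rw [one_mul] at hratio
  filter_upwards [(tendsto_order.1 hratio).1 a hKa, eventually_ge_atTop K] with L hL hLK
  refine hL.trans_le ?_
  rw [div_mul_eq_mul_div, div_le_div_iff_of_pos_right (hcard L)]
  exact card_mul_le_sum_isingCorr_free_box_singleton hβ hh.le hLK

/-- **At zero field the free magnetisation density vanishes identically** (spin-flip symmetry:
`⟨σ_x⟩^∅_{Λ;β,0} = 0`). [cite: FriedliVelenik2017, §3.7.1] -/
theorem boxAverage_isingCorr_free_singleton_zero_field (β : ℝ) (L : ℕ) :
    (∑ x ∈ box d L, isingCorr (zdGraph d) (box d L) β 0 .free {x}) / #(box d L) = 0 := by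
  rw [Finset.sum_eq_zero fun x hx => isingCorr_free_singleton_zero_field (zdGraph d) (box d L) β hx, zero_div]

end IsingSusceptibility

end Summit.CriticalPhenomena.PercolationContinuityZ3.Theorems.FK

end
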